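import Literature.NumberTheory.EllipticCurves.FineSelmerFiniteOfUnramifiedClassesProofs
import Literature.NumberTheory.EllipticCurves.FineSelmerDevissageProofs
import Literature.NumberTheory.EllipticCurves.GoodReductionUnramifiedProofs
import HarnessLib

/-!
# Coates–Sujatha's statement (A) on the REDUCIBLE rows WITHOUT Lim 2017 Thm. 3.5: the dual fine
# Selmer group of `E/ℚ` over `ℚ_cyc` is finitely generated over `ℤ_p` when `E[p]` is reducible,
# in the kernel modulo {Ferrero–Washington, the character form of Iwasawa's `μ = 0`}

Seat `bsd-potss-rkm` g33 (prover; cell `bsd-potss`, HOME `run/shared/lean/pub/bsd-potss/`), item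
stmt-BirchSwinnertonDyer-19196 `ReducibleKatoMember` = crux M of the routes K9
`KatoDescentPotSupersingular` / K8-t′ `KatoDescentTamePotSupersingular` (`--supports`, helper; closes
nothing).  HONEST FRAMING (cell): BSD is not proved by any of this; nothing is booked; crux M stays
cite-level on the ledger.

WHAT THIS FILE DOES.  The sibling `KatoDescentPotSupersingularReducibleFineSelmerMuZero` (g15) proves
statement (A) on the reducible rows modulo {FW, Lim 2017 Thm. 3.5}: Lim's theorem (the `L`-form of
Coates–Sujatha 2005 Thm. 3.4) carries Ferrero–Washington from the ABELIAN Borel field `ℚ(χ₁, χ₂)` up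
the degree-`p` step to `ℚ(E[p])` (Iwasawa's `p`-extension ascent, hidden in the named fact).  Here the
ascent is avoided altogether: by the dévissage of the fine Selmer group of `E[p]` along
`0 → C → E[p] → E[p]/C → 0` (`C` the stable line; Literature
`FineSelmerDevissage.finite_fineSelmerInfty_of_extension`, this seat) and the dialect bridge
`FineSelmerFiniteOfUnramifiedClasses.finite_unramifiedHoms_map_of_finite_unramifiedClasses` (this seat),
`Sel₀(K_∞, E[p])` is finite as soon as the everywhere-unramified homomorphisms on
`Gal(K̄/K(χ₁,χ₂)·K_∞)` with values in `C` and in `E[p]/C` are finite, which is the CHARACTER FORM of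
Iwasawa's `μ = 0` (`IwasawaTheory.classicalMuVanishes_finite_unramifiedClasses`, Lang GTM 121 Ch. 5
structure theory ∘ CFT — an EXISTING classical named fact, typed by cell bsd-2adic) applied to the
cyclotomic `ℤ_p`-extension of `K(χ₁, χ₂)`; for `K = ℚ` that field is abelian and Ferrero–Washington
(`IwasawaTheory.ferreroWashington1979_classicalMuVanishes`) supplies its `μ = 0`.  Then (A) follows by
the Lim–Sujatha bricks (`LimSujatha2018.fineSelmerDual_moduleFinite_iff_finite_fineSelmerInfty_torsion`).

* `quotient action` — inside the proofs only (`letI`): the `Γ_K`-action on `E[p]/C` for a stable `C`.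
* `fineSelmerInfty_torsion_finite_of_reducible` — over a NUMBER FIELD `K`, `p` odd, `κ` cyclotomic,
  `C ≤ E[p]` a stable line: `Sel₀(K_∞, E[p])` is finite, given the char-form fact and
  `ClassicalMuVanishes` of the cyclotomic `ℤ_p`-extension of the Borel field `K(χ₁, χ₂)`
  (`WeierstrassCurve.borelField C`).
* `fineSelmerDual_moduleFinite_of_not_irreducible_of_charForm` — `K = ℚ`: (A) for every `E/ℚ`, odd
  `p` with `E[p]` REDUCIBLE, cyclotomic `κ`, modulo {char-form fact, FW}.  Same conclusion (byte-identical
  type) as g15's `ReducibleFineSelmerMuZero.fineSelmerDual_moduleFinite_of_not_irreducible`, with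
  Lim 3.5 REPLACED by `classicalMuVanishes_finite_unramifiedClasses`.
* `fineSelmerDual_moduleFinite_of_reducibleRow_of_charForm` — the row form used by crux M's chain.

References: [CoatesSujatha2005] Thm. 3.4, Cor. 3.5, Cor. 3.6; [Wuthrich2014] Lemma 14 (p. 396);
[Lang1990] Ch. 5 §§1–4; [FerreroWashington1979]; [LimSujatha2018] §3.
-/

-- the summit and its single problem are both named `BirchSwinnertonDyer` (registry layout D-0017)
set_option linter.dupNamespace false
set_option autoImplicit false

noncomputable section

open scoped Classical Pointwise

namespace Summit.BirchSwinnertonDyer.BirchSwinnertonDyer.Theorems.ReducibleFineSelmerMuZeroCharForm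

open NumberField IsDedekindDomain Field WeierstrassCurve
open Literature.NumberTheory.EllipticCurves Literature.NumberTheory.EllipticCurves.GreenbergSelmer
  Literature.NumberTheory.EllipticCurves.FineSelmerTrivialisingRestriction
  Literature.NumberTheory.EllipticCurves.FineSelmerFiniteOfUnramifiedClasses
  Literature.NumberTheory.EllipticCurves.FineSelmerDevissage
  Literature.NumberTheory.GaloisRepresentations Literature.NumberTheory.IwasawaTheory

/-- **`Sel₀(K_∞, E[p])` is finite on a reducible row, from the classical `μ = 0` of the Borel field.**
`K` a number field, `E/K` elliptic, `p` odd, `κ` the cyclotomic `ℤ_p`-extension, `C ≤ E[p]` a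
`Γ_K`-stable line (`C ≠ 0, E[p]`); assume the character form of Iwasawa's `μ = 0`
(`classicalMuVanishes_finite_unramifiedClasses`) and `ClassicalMuVanishes` for a cyclotomic
`ℤ_p`-extension of the Borel field `K(χ₁, χ₂) = W.borelField C`.  Then `Sel₀(K_∞, E[p])` is finite:
dévissage along `0 → C → E[p] → E[p]/C → 0` over `Gal(K̄/K(χ₁,χ₂)·K_∞)` (which acts trivially on `C`
and `E[p]/C`), the two finiteness inputs being the char-form fact for the trivial modules `C`, `E[p]/C`
transported by the dialect bridge; `E[p]` is unramified outside `{v ∣ p} ∪ {bad v}` (AEC VII.4.1).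
[cite: CoatesSujatha2005, Cor. 3.6 (proof)] [cite: Wuthrich2014, Lemma 14 (p. 396)]
[cite: SilvermanAEC2009, Prop. VII.4.1(a)] -/
theorem fineSelmerInfty_torsion_finite_of_reducible
    (hchar : classicalMuVanishes_finite_unramifiedClasses)
    {K : Type} [Field K] [NumberField K] (W : WeierstrassCurve K) [W.IsElliptic]
    {p : ℕ} [Fact p.Prime] (hp : p ≠ 2) (κ : ZpExtension K p) (hκ : κ.IsCyclotomic)
    (C : AddSubgroup (W.geomTorsion (p : ℤ)))
    (hC : ∀ (σ : absoluteGaloisGroup K) (x : W.geomTorsion (p : ℤ)), x ∈ C → σ • x ∈ C)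
    (h1 : C ≠ ⊥) (h2 : C ≠ ⊤)
    (hμ : haveI : NeZero p := ⟨(Fact.out : p.Prime).ne_zero⟩
      ∀ κF : ZpExtension (W.borelField C) p, κF.IsCyclotomic → ClassicalMuVanishes κF) :
    (fineSelmerInfty (↥(W.geomTorsion (p : ℤ))) κ :
      Set (subgroupH1 κ.kerSubgroup (W.geomTorsion (p : ℤ)))).Finite := by
  have hpr : p.Prime := Fact.out
  haveI : NeZero p := ⟨hpr.ne_zero⟩
  have hodd : Odd p := hpr.odd_of_ne_two hp
  -- the module `M = E[p]`
  haveI hfinM : Finite (W.geomTorsion (p : ℤ)) := W.finite_geomTorsion_nat (NeZero.ne p)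
  have hV : Nat.card (W.geomTorsion (p : ℤ)) = p ^ 2 := W.natCard_geomTorsion_eq_sq_of_charZero hpr
  have hcardC : Nat.card C = p := card_eq_of_ne_bot_of_ne_top hV h1 h2
  -- the Borel field and kernel
  haveI : FiniteDimensional K (W.borelField C) := finiteDimensional_borelField C
  haveI : IsGalois K (W.borelField C) := isGalois_borelField hC
  haveI : NumberField (W.borelField C) := NumberField.of_module_finite K _
  haveI hNn : (W.borelKernel C).Normal := borelKernel_normal hC
  have hNopen : IsOpen (W.borelKernel C : Set (absoluteGaloisGroup K)) := isOpen_borelKernel C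
  have hrange : (absGaloisRestrict K (W.borelField C)).range = W.borelKernel C := by
    rw [range_absGaloisRestrict_eq_fixingSubgroup, fixingSubgroup_borelField]
  obtain ⟨κF, hκF⟩ := ZpExtension.exists_isCyclotomic_holds (W.borelField C) p
    (GaloisRep.cyclotomicCharacter_range_infinite (W.borelField C) p)
  have hker := kerSubgroup_eq_comap_of_isCyclotomic κ hκ κF hκF
  have hmap : κF.kerSubgroup.map (absGaloisRestrict K (W.borelField C)).toMonoidHom =
      W.borelKernel C ⊓ κ.kerSubgroup := map_kerSubgroup_eq_inf κ κF hrange hker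
  have hμF : ClassicalMuVanishes κF := hμ κF hκF
  have hres_mem : ∀ σ : absoluteGaloisGroup (W.borelField C),
      absGaloisRestrict K (W.borelField C) σ ∈ W.borelKernel C := fun σ ↦ hrange ▸ ⟨σ, rfl⟩
  -- the quotient module `Q = E[p]/C` with its `Γ_K`-action
  set M : Type := ↥(W.geomTorsion (p : ℤ)) with hMdef
  letI instQ : DistribMulAction (absoluteGaloisGroup K) (M ⧸ C) :=
    { smul := fun σ ↦ QuotientAddGroup.map C C (DistribSMul.toAddMonoidHom M σ)
        (fun x hx ↦ AddSubgroup.mem_comap.2 (hC σ x hx))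
      one_smul := fun q ↦ QuotientAddGroup.induction_on q fun m ↦ by
        change QuotientAddGroup.map C C (DistribSMul.toAddMonoidHom M 1) _ (m : M ⧸ C) = _
        rw [QuotientAddGroup.map_mk, DistribSMul.toAddMonoidHom_apply, one_smul]
      mul_smul := fun σ τ q ↦ QuotientAddGroup.induction_on q fun m ↦ by
        change QuotientAddGroup.map C C (DistribSMul.toAddMonoidHom M (σ * τ)) _ (m : M ⧸ C) =
          QuotientAddGroup.map C C (DistribSMul.toAddMonoidHom M σ) _
            (QuotientAddGroup.map C C (DistribSMul.toAddMonoidHom M τ) _ (m : M ⧸ C))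
        rw [QuotientAddGroup.map_mk, QuotientAddGroup.map_mk, QuotientAddGroup.map_mk,
          DistribSMul.toAddMonoidHom_apply, DistribSMul.toAddMonoidHom_apply,
          DistribSMul.toAddMonoidHom_apply, mul_smul]
      smul_zero := fun σ ↦ map_zero _
      smul_add := fun σ a b ↦ map_add _ a b }
  letI : TopologicalSpace (M ⧸ C) := ⊥
  haveI : DiscreteTopology (M ⧸ C) := ⟨rfl⟩
  have hsmulQ : ∀ (σ : absoluteGaloisGroup K) (m : M), σ • (m : M ⧸ C) = ((σ • m : M) : M ⧸ C) :=
    fun σ m ↦ rfl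
  let π : M →+ M ⧸ C := QuotientAddGroup.mk' C
  have hπ : ∀ (σ : absoluteGaloisGroup K) (m : M), π (σ • m) = σ • π m := fun σ m ↦ rfl
  have hπker : ∀ m : M, π m = 0 ↔ m ∈ C := fun m ↦ QuotientAddGroup.eq_zero_iff m
  have hNQ : ∀ σ ∈ W.borelKernel C, ∀ q : M ⧸ C, σ • q = q := fun σ hσ q ↦
    QuotientAddGroup.induction_on q fun m ↦ by
      rw [hsmulQ, QuotientAddGroup.eq_iff_sub_mem]
      exact (mem_borelKernel_iff.1 hσ).2 m
  have hNC : ∀ σ ∈ W.borelKernel C, ∀ m : M, π m = 0 → σ • m = m := fun σ hσ m hm ↦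
    (mem_borelKernel_iff.1 hσ).1 m ((hπker m).1 hm)
  -- the finite set `S` of places above `p` and bad places; `E[p]` unramified outside `S`
  have hSfin : ({v : HeightOneSpectrum (𝓞 K) | (p : 𝓞 K) ∈ v.asIdeal} ∪ W.badPlaces (𝓞 K)).Finite := by
    refine Set.Finite.union ?_ (W.finite_badPlaces_holds (𝓞 K))
    have hne : Ideal.span {(p : 𝓞 K)} ≠ 0 := by
      rw [Ideal.zero_eq_bot, Ne, Ideal.span_singleton_eq_bot]
      exact_mod_cast hpr.ne_zero
    refine (Ideal.finite_factors hne).subset fun v hv ↦ ?_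
    simp only [Set.mem_setOf_eq] at hv ⊢
    exact Ideal.dvd_iff_le.mpr ((Ideal.span_singleton_le_iff_mem _).mpr hv)
  have hunr : ∀ v ∉ ({v : HeightOneSpectrum (𝓞 K) | (p : 𝓞 K) ∈ v.asIdeal} ∪ W.badPlaces (𝓞 K)),
      ∀ 𝔓 ∈ v.primesAbove, ∀ σ ∈ 𝔓.inertia (absoluteGaloisGroup K), ∀ m : M, σ • m = m := by
    intro v hv 𝔓 h𝔓 σ hσ m
    rw [Set.mem_union, not_or, Set.mem_setOf_eq, mem_badPlaces_iff, not_not] at hv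
    exact W.smul_geomTorsion_eq_of_mem_inertia hv.2 (n := (p : ℤ)) (by exact_mod_cast hv.1) h𝔓 hσ m
  -- (Q) everywhere-unramified homs with values in `E[p]/C` are finite
  have hQfin : (unramifiedHoms (W.borelKernel C ⊓ κ.kerSubgroup) (M ⧸ C)
      (∅ : Set (HeightOneSpectrum (𝓞 K)))).Finite := by
    letI instFQ : DistribMulAction (absoluteGaloisGroup (W.borelField C)) (M ⧸ C) :=
      DistribMulAction.compHom _ (absGaloisRestrict K (W.borelField C)).toMonoidHom
    have htrivQ : ∀ (σ : absoluteGaloisGroup (W.borelField C)) (q : M ⧸ C), σ • q = q :=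
      fun σ q ↦ hNQ _ (hres_mem σ) q
    have hcardQ : ∃ k : ℕ, Nat.card (M ⧸ C) = p ^ k := by
      refine ⟨1, ?_⟩
      have h := AddSubgroup.card_eq_card_quotient_mul_card_addSubgroup C
      rw [hV, hcardC, pow_two] at h
      rw [pow_one]
      exact (Nat.eq_of_mul_eq_mul_right hpr.pos h).symm
    have hfinF := hchar (W.borelField C) p κF (Or.inl hodd) hμF (M ⧸ C) hcardQ htrivQ
    have h := finite_unramifiedHoms_map_of_finite_unramifiedClasses (K := K) htrivQ κF hfinF
    rwa [hmap] at h
  -- (C) `C`-valued everywhere-unramified homs are finite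
  have hCfin : {f ∈ unramifiedHoms (W.borelKernel C ⊓ κ.kerSubgroup) M
      (∅ : Set (HeightOneSpectrum (𝓞 K))) | ∀ u, π (f u) = 0}.Finite := by
    letI instFC : DistribMulAction (absoluteGaloisGroup (W.borelField C)) C :=
      { smul := fun _ c ↦ c
        one_smul := fun _ ↦ rfl
        mul_smul := fun _ _ _ ↦ rfl
        smul_zero := fun _ ↦ rfl
        smul_add := fun _ _ _ ↦ rfl }
    have htrivC : ∀ (σ : absoluteGaloisGroup (W.borelField C)) (c : C), σ • c = c := fun _ _ ↦ rfl
    have hcardC' : ∃ k : ℕ, Nat.card C = p ^ k := ⟨1, by rw [pow_one]; exact hcardC⟩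
    have hfinF := hchar (W.borelField C) p κF (Or.inl hodd) hμF C hcardC' htrivC
    have h := finite_unramifiedHoms_map_of_finite_unramifiedClasses (K := K) htrivC κF hfinF
    rw [hmap] at h
    -- every `C`-valued member of `Hom(U, M; ∅)` is the image of a member of `Hom(U, C; ∅)`
    refine (h.image fun (f' : ↥(W.borelKernel C ⊓ κ.kerSubgroup) → C) u ↦ (f' u : M)).subset ?_
    rintro f ⟨hf, hfπ⟩
    have hfC : ∀ u, f u ∈ C := fun u ↦ (hπker _).1 (hfπ u)
    refine ⟨fun u ↦ ⟨f u, hfC u⟩, ⟨hf.1.subtype_mk _, fun σ τ ↦ Subtype.ext (hf.2.1 σ τ),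
      fun v hv 𝔓 h𝔓 σ hσ ↦ Subtype.ext (hf.2.2 v hv 𝔓 h𝔓 σ hσ)⟩, rfl⟩
  -- dévissage
  exact finite_fineSelmerInfty_of_extension κ hκ π hπ (W.borelKernel C) hNopen hNQ hNC _ hSfin hunr
    hQfin hCfin

/-- **Statement (A) on the REDUCIBLE rows, modulo {character form of `μ = 0`, Ferrero–Washington} —
NO Lim 2017 Thm. 3.5, NO `p`-extension ascent, NO `ℚ(E[p])`.**  For every elliptic `E/ℚ`, every odd
prime `p` with `E[p]` REDUCIBLE and every cyclotomic `ℤ_p`-extension `κ` of `ℚ`: the Pontryagin dual of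
the fine Selmer group of `E` over `ℚ_cyc` is finitely generated over `ℤ_p`, in the tree's
`∃ γ D, Module.Finite ℤ_[p] D.X` spelling (byte-identical with g15's
`ReducibleFineSelmerMuZero.fineSelmerDual_moduleFinite_of_not_irreducible`, whose inputs were
{Lim 3.5, FW}).  Proof: a stable line `C` exists; the Borel field `ℚ(χ₁, χ₂)` is finite ABELIAN
(`isAbelianGalois_borelField`), so FW gives `ClassicalMuVanishes` for its cyclotomic `ℤ_p`-extension;
`fineSelmerInfty_torsion_finite_of_reducible`; Lim–Sujatha bricks.
[cite: Wuthrich2014, Lemma 14 (p. 396)] [cite: CoatesSujatha2005, Cor. 3.6] [cite: FerreroWashington1979, main theorem] -/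
theorem fineSelmerDual_moduleFinite_of_not_irreducible_of_charForm
    (hchar : classicalMuVanishes_finite_unramifiedClasses)
    (hFW : ferreroWashington1979_classicalMuVanishes)
    (W : WeierstrassCurve ℚ) [W.IsElliptic] (p : ℕ) [Fact p.Prime] (hp : p ≠ 2)
    (hred : ¬ W.HasIrreducibleModPGaloisRep p) (κ : ZpExtension ℚ p) (hκ : κ.IsCyclotomic) :
    ∃ (γ : Field.absoluteGaloisGroup ℚ) (D : W.FineSelmerDualData κ γ),
      Module.Finite ℤ_[p] (RestrictScalars ℤ_[p] (IwasawaAlgebra p) D.X) := by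
  have hpr : p.Prime := Fact.out
  haveI : NeZero p := ⟨hpr.ne_zero⟩
  rw [LimSujatha2018.fineSelmerDual_moduleFinite_iff_finite_fineSelmerInfty_torsion W hp κ hκ]
  -- a stable line
  obtain ⟨C, hC, h1, h2⟩ : ∃ C : AddSubgroup (W.geomTorsion (p : ℤ)),
      (∀ (σ : absoluteGaloisGroup ℚ) (x : W.geomTorsion (p : ℤ)), x ∈ C → σ • x ∈ C) ∧
        C ≠ ⊥ ∧ C ≠ ⊤ := by
    unfold HasIrreducibleModPGaloisRep at hred
    push Not at hred
    obtain ⟨C, hC, h1, h2⟩ := hred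
    exact ⟨C, hC, h1, h2⟩
  have hV : Nat.card (W.geomTorsion (p : ℤ)) = p ^ 2 := W.natCard_geomTorsion_eq_sq_of_charZero hpr
  have hcardC : Nat.card C = p := card_eq_of_ne_bot_of_ne_top hV h1 h2
  refine fineSelmerInfty_torsion_finite_of_reducible hchar W hp κ hκ C hC h1 h2 fun κF hκF ↦ ?_
  haveI : FiniteDimensional ℚ (W.borelField C) := finiteDimensional_borelField C
  haveI : IsAbelianGalois ℚ (W.borelField C) := isAbelianGalois_borelField hC hcardC hV
  haveI : NumberField (W.borelField C) := NumberField.mk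
  exact hFW (W.borelField C) p κF hκF

/-- The same, on the rows of crux M (`E[p]` reducible at an additive potentially good `p ≠ 2`; the
reduction hypotheses are idle for (A)): statement (A) for `W` at `p`, modulo {char-form `μ = 0`, FW}
— the `hLim`-free twin of g15's `fineSelmerDual_moduleFinite_of_reducibleRow`.
[cite: Wuthrich2014, Lemma 14 (p. 396)] [cite: Kato2004Asterisque, Rem. 12.7 (p. 222) (potentially good)] -/
theorem fineSelmerDual_moduleFinite_of_reducibleRow_of_charForm
    (hchar : classicalMuVanishes_finite_unramifiedClasses)
    (hFW : ferreroWashington1979_classicalMuVanishes)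
    (W : WeierstrassCurve ℚ) [W.IsElliptic] [W.IsGloballyMinimal] (p : ℕ) [Fact p.Prime] (hp : p ≠ 2)
    (_hg : ¬ W.HasGoodReductionAtPrime p) (_hm : ¬ W.HasMultiplicativeReductionAtPrime p)
    (_hj : 0 ≤ padicValRat p W.j) (hred : ¬ W.HasIrreducibleModPGaloisRep p)
    (κ : ZpExtension ℚ p) (hκ : κ.IsCyclotomic) :
    ∃ (γ : Field.absoluteGaloisGroup ℚ) (D : W.FineSelmerDualData κ γ),
      Module.Finite ℤ_[p] (RestrictScalars ℤ_[p] (IwasawaAlgebra p) D.X) :=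
  fineSelmerDual_moduleFinite_of_not_irreducible_of_charForm hchar hFW W p hp hred κ hκ

end Summit.BirchSwinnertonDyer.BirchSwinnertonDyer.Theorems.ReducibleFineSelmerMuZeroCharForm

end
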